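import Literature.NumberTheory.Sieve.FriedlanderIwaniecPrimes
import Literature.NumberTheory.Sieve.AsymptoticSieveForPrimesProofs
import Literature.NumberTheory.Sieve.SmoothMajorantLocal
import HarnessLib

/-!
# Asymptotic sieve for primes, Theorem 2 (arbitrary support): the squarefree-supported sequence `ã_n = μ²(n) a_n`, its density `g̃` and the constant `G = ∏_p (1 - g(p²))`

Topic `Literature/NumberTheory/Sieve` (trunk T-SIEVE). Source: J. Friedlander, H. Iwaniec,
*Asymptotic sieve for primes*, Ann. of Math. 148 (1998) 1041–1065 [FriedlanderIwaniecASP1998]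
(= arXiv:math/9811186), §9 "A generalization", pp. 1058–1063: Theorem 2 and its proof through
(9.4) `ã_n = μ²(n) a_n`, (9.5) `g̃(p) = (g(p) - g(p²))/(1 - g(p²))`, (9.8) `G = ∏_p (1 - g(p²))`,
(9.13) `H̃ = ∏_p (1 - g̃(p))(1 - 1/p)⁻¹ = H G⁻¹`; used for [FriedlanderIwaniecAnnals1998]
Proposition 2.1 (= ASP Theorems 2–3), `Literature.NumberTheory.Sieve.FriedlanderIwaniec1998_prop21`.

FI prove Theorem 2 (sequences supported on all integers) by applying Theorem 1 (squarefree
support) to `ã`. This file supplies the DEFINITIONS of that reduction for a general sifted sequence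
`A` over the tree's `SieveSequence` API, generalising the tree's `fiDensitySq`, `fiSieveSeqSq`,
`fiSqProd`, `fiSqConst` (`FriedlanderIwaniecPrimesSquarefree`, which treat FI's specific sequence
`#{(a,c) : a² + c⁴ = n}` only), together with their algebraic API:

* `moebiusSqDensity g` (`g̃`, (9.5)): the multiplicative function with `g̃(p) = (g(p)-g(p²))/(1-g(p²))`,
  `g̃(p^k) = 0` (`k ≥ 2`); under (9.1)/(2.4) `0 ≤ g(p²) ≤ g(p) < 1`: `0 ≤ g̃(p) ≤ g(p) < 1`,
  `1 - g̃(p) = (1 - g(p))/(1 - g(p²))`, `0 ≤ g(p) - g̃(p) ≤ g(p²)/(1 - g(p²))`;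
* `SieveSequence.moebiusSq A` (`ã`, (9.4)): `ã_n = μ²(n) a_n`, size `Ã(x) = ∑_{n ≤ x} ã_n` (FI's
  normalisation `size_eq`), density `g̃`; `ã_p = a_p`, `Ã_d ≤ A_d`, `Ã_d = 0` off squarefree `d`;
* `sqProd g Y = ∏_{p ≤ Y} (1 - g(p²))` and `sqConst g = G = inf_Y sqProd g Y` ((9.8)); under (2.4) and
  (2.6) `g(p²) ≤ K/p²`: `0 < G ≤ sqProd g Y ≤ 1`, `sqProd g Y → G`, `sqProd g Y - G ≤ K/Y`;
* `SieveSequence.hasDensityConstant_moebiusSq`: `H̃ = H/G` ((9.13)) in the tree's sense of ordered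
  partial Euler products (`HasDensityConstant`).

The analytic part of §9 ((R₃) ⟹ (R) for `ã`, (9.12) `Ã(x) = G A(x)(1 + O((log x)⁻¹))`) and the
deduction of Theorem 2/Proposition 2.1 are in the sequels `…Theorem2Identities`, `…Theorem2Tails`,
`…Theorem2`.

## References

* J. Friedlander, H. Iwaniec, *Asymptotic sieve for primes*, Ann. of Math. 148 (1998), 1041–1065,
  §9 (9.1)–(9.14), Theorem 2. [cite: FriedlanderIwaniecASP1998, §9 Theorem 2]
* J. Friedlander, H. Iwaniec, *The polynomial `X² + Y⁴` captures its primes*, Ann. of Math. 148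
  (1998), 945–1040, §2 Proposition 2.1. [cite: FriedlanderIwaniecAnnals1998, Proposition 2.1]

## Mathlib / tree search

Tree (patterns generalised, nothing redefined for FI's sequence): `fiDensitySq`, `fiSieveSeqSq`,
`fiSqProd`, `fiSqConst`, `hasDensityConstant_fiSieveSeqSq` (`FriedlanderIwaniecPrimesSquarefree`);
reused: `SieveSequence`, `congrSum`, `remainder`, `HasDensityConstant`,
`CFZ.one_sub_sum_le_prod_one_sub` (Weierstrass' inequality, `SmoothMajorantLocal`). Mathlib:
`Nat.factorization`, `Finsupp.prod_add_index_of_disjoint`, `tendsto_atTop_ciInf`,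
`sum_Ioc_inv_sq_le_sub`. `lean search 'moebiusSq|sqProd|sqConst'`: no such declaration before
this file.
-/

noncomputable section

open Filter Finset Real
open scoped Topology ArithmeticFunction.sigma

namespace Literature.NumberTheory.Sieve

/-! ### The density `g̃` of `μ²(n) a_n` ((9.5)) -/

/-- The values of `g̃` on prime powers: `g̃(1) = 1`, `g̃(p) = (g(p) - g(p²))/(1 - g(p²))` ((9.5)),
`g̃(p^k) = 0` for `k ≥ 2` (the squarefree-supported sequence has no mass on multiples of `p²`).
[cite: FriedlanderIwaniecASP1998, (9.5)] -/
def moebiusSqDensityPrimePow (g : ArithmeticFunction ℝ) (p k : ℕ) : ℝ :=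
  if k = 0 then 1 else if k = 1 then (g p - g (p ^ 2)) / (1 - g (p ^ 2)) else 0

/-- The density `g̃` of the squarefree-supported sequence `ã_n = μ²(n) a_n` ((9.5)), extended
multiplicatively (`g̃(0) = 0`): `g̃(d) = ∏_{p ∣ d} (g(p) - g(p²))/(1 - g(p²))` for squarefree `d`,
`g̃(d) = 0` otherwise. [cite: FriedlanderIwaniecASP1998, (9.5)] -/
def moebiusSqDensity (g : ArithmeticFunction ℝ) : ArithmeticFunction ℝ :=
  ⟨fun d => if d = 0 then 0 else d.factorization.prod fun p k => moebiusSqDensityPrimePow g p k,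
    if_pos rfl⟩

variable (g : ArithmeticFunction ℝ)

/-- Unfolding `moebiusSqDensity` at `d ≠ 0`. [folklore] -/
theorem moebiusSqDensity_apply {d : ℕ} (hd : d ≠ 0) :
    moebiusSqDensity g d = d.factorization.prod fun p k => moebiusSqDensityPrimePow g p k := by
  simp [moebiusSqDensity, hd]

/-- `g̃` is multiplicative. [folklore] -/
theorem isMultiplicative_moebiusSqDensity : (moebiusSqDensity g).IsMultiplicative := by
  refine ArithmeticFunction.IsMultiplicative.iff_ne_zero.mpr ⟨by simp [moebiusSqDensity], ?_⟩
  intro m n hm hn hmn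
  rw [moebiusSqDensity_apply g hm, moebiusSqDensity_apply g hn,
    moebiusSqDensity_apply g (mul_ne_zero hm hn), Nat.factorization_mul_of_coprime hmn,
    Finsupp.prod_add_index_of_disjoint]
  simpa [Nat.support_factorization] using hmn.disjoint_primeFactors

/-- `g̃(p^k)` on a prime power. [folklore] -/
theorem moebiusSqDensity_prime_pow {p : ℕ} (hp : p.Prime) (k : ℕ) :
    moebiusSqDensity g (p ^ k) = moebiusSqDensityPrimePow g p k := by
  rw [moebiusSqDensity_apply g (pow_ne_zero k hp.ne_zero), hp.factorization_pow,
    Finsupp.prod_single_index]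
  simp [moebiusSqDensityPrimePow]

/-- `g̃(p) = (g(p) - g(p²))/(1 - g(p²))` ((9.5)). [cite: FriedlanderIwaniecASP1998, (9.5)] -/
theorem moebiusSqDensity_prime {p : ℕ} (hp : p.Prime) :
    moebiusSqDensity g p = (g p - g (p ^ 2)) / (1 - g (p ^ 2)) := by
  simpa [moebiusSqDensityPrimePow] using moebiusSqDensity_prime_pow g hp 1

/-- `g̃(p^k) = 0` for `k ≥ 2`. [folklore] -/
theorem moebiusSqDensity_prime_pow_eq_zero {p : ℕ} (hp : p.Prime) {k : ℕ} (hk : 2 ≤ k) :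
    moebiusSqDensity g (p ^ k) = 0 := by
  rw [moebiusSqDensity_prime_pow g hp k]
  simp [moebiusSqDensityPrimePow, show k ≠ 0 by omega, show k ≠ 1 by omega]

/-- `g̃(d) = 0` unless `d` is squarefree. [folklore] -/
theorem moebiusSqDensity_eq_zero_of_not_squarefree {d : ℕ} (hd : ¬Squarefree d) :
    moebiusSqDensity g d = 0 := by
  rcases eq_or_ne d 0 with rfl | hd0
  · simp [moebiusSqDensity]
  obtain ⟨p, hp, hpd⟩ : ∃ p, Nat.Prime p ∧ p * p ∣ d := by
    by_contra h
    exact hd (Nat.squarefree_iff_prime_squarefree.mpr fun p hp hpd => h ⟨p, hp, hpd⟩)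
  set k := d.factorization p with hk
  have hk2 : 2 ≤ k := by
    rw [hk, ← hp.pow_dvd_iff_le_factorization hd0, pow_two]; exact hpd
  obtain ⟨e, he, hpe⟩ : ∃ e, d = p ^ k * e ∧ ¬p ∣ e :=
    ⟨d / p ^ k, (Nat.mul_div_cancel' (Nat.ordProj_dvd d p)).symm, Nat.not_dvd_ordCompl hp hd0⟩
  have hcop : (p ^ k).Coprime e := (Nat.coprime_pow_left_iff (by omega) _ _).mpr
    ((Nat.Prime.coprime_iff_not_dvd hp).mpr hpe)
  rw [he, (isMultiplicative_moebiusSqDensity g).map_mul_of_coprime hcop,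
    moebiusSqDensity_prime_pow_eq_zero g hp hk2, zero_mul]

/-- For squarefree `d`, `g̃(d) = ∏_{p ∣ d} g̃(p)`. [folklore] -/
theorem moebiusSqDensity_eq_prod_of_squarefree {d : ℕ} (hd : Squarefree d) :
    moebiusSqDensity g d = ∏ p ∈ d.primeFactors, moebiusSqDensity g p :=
  ((isMultiplicative_moebiusSqDensity g).prod_primeFactors hd).symm

variable {g}

/-- Under (2.4) `g(p²) ≤ g(p) < 1`: `1 - g(p²) > 0`. [cite: FriedlanderIwaniecAnnals1998, (2.4)] -/
theorem one_sub_sq_pos_of_hyp24 {p : ℕ}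
    (h : 0 ≤ g (p ^ 2) ∧ g (p ^ 2) ≤ g p ∧ g p < 1) : 0 < 1 - g (p ^ 2) := by
  linarith [h.2.1, h.2.2]

/-- `g̃(p)(1 - g(p²)) = g(p) - g(p²)`. [folklore] -/
theorem moebiusSqDensity_prime_mul_one_sub {p : ℕ} (hp : p.Prime)
    (h : 0 ≤ g (p ^ 2) ∧ g (p ^ 2) ≤ g p ∧ g p < 1) :
    moebiusSqDensity g p * (1 - g (p ^ 2)) = g p - g (p ^ 2) := by
  rw [moebiusSqDensity_prime g hp, div_mul_cancel₀ _ (one_sub_sq_pos_of_hyp24 h).ne']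

/-- `1 - g̃(p) = (1 - g(p))/(1 - g(p²))` (the Euler factors of `H̃` and `H` differ by `(1-g(p²))⁻¹`,
(9.13)). [cite: FriedlanderIwaniecASP1998, (9.13)] -/
theorem one_sub_moebiusSqDensity_prime {p : ℕ} (hp : p.Prime)
    (h : 0 ≤ g (p ^ 2) ∧ g (p ^ 2) ≤ g p ∧ g p < 1) :
    1 - moebiusSqDensity g p = (1 - g p) / (1 - g (p ^ 2)) := by
  rw [moebiusSqDensity_prime g hp]
  have h' := (one_sub_sq_pos_of_hyp24 h).ne'
  field_simp
  ring

/-- `0 ≤ g̃(p)`. [folklore] -/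
theorem moebiusSqDensity_prime_nonneg {p : ℕ} (hp : p.Prime)
    (h : 0 ≤ g (p ^ 2) ∧ g (p ^ 2) ≤ g p ∧ g p < 1) : 0 ≤ moebiusSqDensity g p := by
  rw [moebiusSqDensity_prime g hp]
  exact div_nonneg (by linarith [h.2.1]) (one_sub_sq_pos_of_hyp24 h).le

/-- `g̃(p) ≤ g(p)`. [folklore] -/
theorem moebiusSqDensity_prime_le {p : ℕ} (hp : p.Prime)
    (h : 0 ≤ g (p ^ 2) ∧ g (p ^ 2) ≤ g p ∧ g p < 1) : moebiusSqDensity g p ≤ g p := by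
  rw [moebiusSqDensity_prime g hp, div_le_iff₀ (one_sub_sq_pos_of_hyp24 h)]
  nlinarith [h.1, h.2.1, h.2.2]

/-- `g̃(p) < 1`. [folklore] -/
theorem moebiusSqDensity_prime_lt_one {p : ℕ} (hp : p.Prime)
    (h : 0 ≤ g (p ^ 2) ∧ g (p ^ 2) ≤ g p ∧ g p < 1) : moebiusSqDensity g p < 1 :=
  (moebiusSqDensity_prime_le hp h).trans_lt h.2.2

/-- `0 ≤ g(p) - g̃(p) ≤ g(p²)/(1 - g(p²))`: `g̃` is a perturbation of `g` by `O(g(p²))` at the primes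
("`g̃(p)` satisfies (1.8) and (1.9) due to (9.1)", FI p. 1061). [cite: FriedlanderIwaniecASP1998, §9 p. 1061] -/
theorem sub_moebiusSqDensity_prime_le {p : ℕ} (hp : p.Prime)
    (h : 0 ≤ g (p ^ 2) ∧ g (p ^ 2) ≤ g p ∧ g p < 1) :
    0 ≤ g p - moebiusSqDensity g p ∧ g p - moebiusSqDensity g p ≤ g (p ^ 2) / (1 - g (p ^ 2)) := by
  have h1 := one_sub_sq_pos_of_hyp24 h
  have heq : g p - moebiusSqDensity g p = g (p ^ 2) * (1 - g p) / (1 - g (p ^ 2)) := by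
    rw [moebiusSqDensity_prime g hp]
    field_simp
    ring
  refine ⟨sub_nonneg.mpr (moebiusSqDensity_prime_le hp h), ?_⟩
  rw [heq, div_le_div_iff_of_pos_right h1]
  nlinarith [h.1, h.2.1, h.2.2]

/-- For squarefree `d`: `0 ≤ g̃(d) ≤ g(d)` (termwise on the prime factors). [folklore] -/
theorem moebiusSqDensity_squarefree_nonneg_le (hg : g.IsMultiplicative)
    (h24 : ∀ p : ℕ, p.Prime → 0 ≤ g (p ^ 2) ∧ g (p ^ 2) ≤ g p ∧ g p < 1) {d : ℕ}
    (hd : Squarefree d) : 0 ≤ moebiusSqDensity g d ∧ moebiusSqDensity g d ≤ g d := by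
  rw [← (isMultiplicative_moebiusSqDensity g).prod_primeFactors hd, ← hg.prod_primeFactors hd]
  refine ⟨Finset.prod_nonneg fun p hp => moebiusSqDensity_prime_nonneg
      (Nat.prime_of_mem_primeFactors hp) (h24 p (Nat.prime_of_mem_primeFactors hp)),
    Finset.prod_le_prod (fun p hp => moebiusSqDensity_prime_nonneg
      (Nat.prime_of_mem_primeFactors hp) (h24 p (Nat.prime_of_mem_primeFactors hp)))
      fun p hp => moebiusSqDensity_prime_le (Nat.prime_of_mem_primeFactors hp)
        (h24 p (Nat.prime_of_mem_primeFactors hp))⟩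

/-- `g̃(d) ≥ 0` for every `d`. [folklore] -/
theorem moebiusSqDensity_nonneg (hg : g.IsMultiplicative)
    (h24 : ∀ p : ℕ, p.Prime → 0 ≤ g (p ^ 2) ∧ g (p ^ 2) ≤ g p ∧ g p < 1) (d : ℕ) :
    0 ≤ moebiusSqDensity g d := by
  by_cases hd : Squarefree d
  · exact (moebiusSqDensity_squarefree_nonneg_le hg h24 hd).1
  · rw [moebiusSqDensity_eq_zero_of_not_squarefree g hd]

/-- `g(d) ≥ 0` for squarefree `d` under (2.4). [folklore] -/
theorem density_squarefree_nonneg (hg : g.IsMultiplicative)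
    (h24 : ∀ p : ℕ, p.Prime → 0 ≤ g (p ^ 2) ∧ g (p ^ 2) ≤ g p ∧ g p < 1) {d : ℕ}
    (hd : Squarefree d) : 0 ≤ g d := by
  rw [← hg.prod_primeFactors hd]
  exact Finset.prod_nonneg fun p hp =>
    (h24 p (Nat.prime_of_mem_primeFactors hp)).1.trans (h24 p (Nat.prime_of_mem_primeFactors hp)).2.1

/-! ### The squarefree-supported sequence `ã_n = μ²(n) a_n` ((9.4)) -/

namespace SieveSequence

/-- **`ã = μ² a`** ((9.4)): the squarefree-supported sequence `ã_n = μ²(n) a_n` attached to a sifted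
sequence `A`, with FI's normalisation of the size, `Ã(x) = ∑_{n ≤ x} ã_n` itself, and the density
`g̃` of (9.5). "We shall apply Theorem 1 for the sequence `𝒜̃ = (ã_n)` with `ã_n = μ²(n) a_n`."
[cite: FriedlanderIwaniecASP1998, (9.4)-(9.6)] -/
def moebiusSq (A : SieveSequence) : SieveSequence where
  a n := if Squarefree n then A.a n else 0
  a_nonneg n := by
    split_ifs
    · exact A.a_nonneg n
    · exact le_rfl
  size x := ∑ n ∈ (Ioc 0 ⌊x⌋₊).filter (1 ∣ ·), if Squarefree n then A.a n else 0
  density := moebiusSqDensity A.density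
  density_mult := isMultiplicative_moebiusSqDensity A.density

variable (A : SieveSequence)

/-- `ã_n = a_n` for squarefree `n`, `0` otherwise. [folklore] -/
theorem moebiusSq_a (n : ℕ) : A.moebiusSq.a n = if Squarefree n then A.a n else 0 := rfl

/-- The density of `ã` is `g̃`. [folklore] -/
theorem moebiusSq_density : A.moebiusSq.density = moebiusSqDensity A.density := rfl

/-- `ã_n = a_n` for squarefree `n`. [folklore] -/
theorem moebiusSq_a_of_squarefree {n : ℕ} (hn : Squarefree n) : A.moebiusSq.a n = A.a n := by
  rw [moebiusSq_a, if_pos hn]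

/-- `ã_n = 0` off the squarefree integers ((1.16) for `ã`). [cite: FriedlanderIwaniecASP1998, (1.16)] -/
theorem moebiusSq_a_of_not_squarefree {n : ℕ} (hn : ¬Squarefree n) : A.moebiusSq.a n = 0 := by
  rw [moebiusSq_a, if_neg hn]

/-- `ã_p = a_p` at primes. [folklore] -/
theorem moebiusSq_a_prime {p : ℕ} (hp : p.Prime) : A.moebiusSq.a p = A.a p :=
  A.moebiusSq_a_of_squarefree hp.squarefree

/-- `0 ≤ ã_n ≤ a_n`. [folklore] -/
theorem moebiusSq_a_le (n : ℕ) : A.moebiusSq.a n ≤ A.a n := by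
  rw [moebiusSq_a]
  split_ifs
  · exact le_rfl
  · exact A.a_nonneg n

/-- `size_eq` for `ã`: `Ã.size x = Ã_1(x) = ∑_{n ≤ x} ã_n` (FI (1.3), (2.3)). [folklore] -/
theorem moebiusSq_size_eq (x : ℝ) : A.moebiusSq.size x = A.moebiusSq.congrSum 1 x := rfl

/-- `Ã_d(x) ≤ A_d(x)`. [folklore] -/
theorem moebiusSq_congrSum_le (d : ℕ) (x : ℝ) : A.moebiusSq.congrSum d x ≤ A.congrSum d x :=
  Finset.sum_le_sum fun n _ => A.moebiusSq_a_le n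

/-- `0 ≤ Ã(x) ≤ A_1(x)`. [folklore] -/
theorem moebiusSq_size_nonneg_le (x : ℝ) :
    0 ≤ A.moebiusSq.size x ∧ A.moebiusSq.size x ≤ A.congrSum 1 x := by
  rw [moebiusSq_size_eq]
  exact ⟨A.moebiusSq.congrSum_nonneg 1 x, A.moebiusSq_congrSum_le 1 x⟩

/-- `Ã_d(x) = 0` unless `d` is squarefree. [folklore] -/
theorem moebiusSq_congrSum_eq_zero {d : ℕ} (hd : ¬Squarefree d) (x : ℝ) :
    A.moebiusSq.congrSum d x = 0 := by
  refine Finset.sum_eq_zero fun n hn => ?_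
  rw [Finset.mem_filter] at hn
  exact A.moebiusSq_a_of_not_squarefree fun h => hd (h.squarefree_of_dvd hn.2)

/-- `r̃_d(x) = 0` unless `d` is squarefree. [folklore] -/
theorem moebiusSq_remainder_eq_zero {d : ℕ} (hd : ¬Squarefree d) (x : ℝ) :
    A.moebiusSq.remainder d x = 0 := by
  rw [SieveSequence.remainder, A.moebiusSq_congrSum_eq_zero hd, moebiusSq_density,
    moebiusSqDensity_eq_zero_of_not_squarefree _ hd]
  ring

/-- The prime sums of `ã` and `a` agree: `∑_{p ≤ x} ã_p log p = ∑_{p ≤ x} a_p log p`. [folklore] -/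
theorem moebiusSq_primeSum (x : ℝ) :
    ∑ p ∈ Nat.primesLE ⌊x⌋₊, A.moebiusSq.a p * Real.log p =
      ∑ p ∈ Nat.primesLE ⌊x⌋₊, A.a p * Real.log p :=
  Finset.sum_congr rfl fun p hp => by rw [A.moebiusSq_a_prime (Nat.prime_of_mem_primesLE hp)]

/-- `Ã(x)` written as the sum of `a_n` over the squarefree `n ≤ x`. [folklore] -/
theorem moebiusSq_size_eq_sum_filter (x : ℝ) :
    A.moebiusSq.size x = ∑ n ∈ (Ioc 0 ⌊x⌋₊).filter Squarefree, A.a n := by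
  rw [moebiusSq_size_eq, SieveSequence.congrSum, Finset.sum_filter, Finset.sum_filter]
  refine Finset.sum_congr rfl fun n _ => ?_
  rw [if_pos (one_dvd n), moebiusSq_a]

end SieveSequence

/-! ### The product `∏_{p ≤ Y} (1 - g(p²))` and its limit `G` ((9.8)) -/

/-- `sqProd g Y = ∏_{p ≤ Y} (1 - g(p²))`, the partial products of (9.8). [cite: FriedlanderIwaniecASP1998, (9.8)] -/
def sqProd (g : ArithmeticFunction ℝ) (Y : ℕ) : ℝ := ∏ p ∈ Nat.primesLE Y, (1 - g (p ^ 2))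

/-- `G = ∏_p (1 - g(p²)) = inf_Y ∏_{p ≤ Y} (1 - g(p²))` ((9.8); the partial products decrease under
(2.4)). [cite: FriedlanderIwaniecASP1998, (9.8)] -/
def sqConst (g : ArithmeticFunction ℝ) : ℝ := ⨅ Y : ℕ, sqProd g Y

section Products

variable (h24 : ∀ p : ℕ, p.Prime → 0 ≤ g (p ^ 2) ∧ g (p ^ 2) ≤ g p ∧ g p < 1)
include h24

/-- `0 < sqProd g Y ≤ 1`. [folklore] -/
theorem sqProd_pos_le_one (Y : ℕ) : 0 < sqProd g Y ∧ sqProd g Y ≤ 1 := by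
  refine ⟨Finset.prod_pos fun p hp => one_sub_sq_pos_of_hyp24 (h24 p (Nat.prime_of_mem_primesLE hp)),
    Finset.prod_le_one (fun p hp =>
      (one_sub_sq_pos_of_hyp24 (h24 p (Nat.prime_of_mem_primesLE hp))).le) fun p hp => ?_⟩
  linarith [(h24 p (Nat.prime_of_mem_primesLE hp)).1]

/-- `sqProd g` is non-increasing. [folklore] -/
theorem sqProd_anti : Antitone (sqProd g) := by
  refine antitone_nat_of_succ_le fun y => ?_
  unfold sqProd
  have hsub : Nat.primesLE y ⊆ Nat.primesLE (y + 1) := fun p hp => by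
    rw [Nat.mem_primesLE] at hp ⊢; exact ⟨hp.1.trans (Nat.le_succ y), hp.2⟩
  exact Finset.prod_le_prod_of_subset_of_le_one hsub
    (fun p hp => (one_sub_sq_pos_of_hyp24 (h24 p (Nat.prime_of_mem_primesLE hp))).le)
    fun p hp _ => by linarith [(h24 p (Nat.prime_of_mem_primesLE hp)).1]

omit h24 in
/-- The product over a segment of primes: for `y ≤ z`,
`sqProd g z = sqProd g y · ∏_{y < p ≤ z} (1 - g(p²))`. [folklore] -/
theorem sqProd_eq_mul_prod_filter {y z : ℕ} (hyz : y ≤ z) :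
    sqProd g z = sqProd g y * ∏ p ∈ (Nat.primesLE z).filter (fun p => y < p), (1 - g (p ^ 2)) := by
  unfold sqProd
  rw [← Finset.prod_union]
  · congr 1
    ext p
    simp only [Finset.mem_union, Finset.mem_filter, Nat.mem_primesLE]
    constructor
    · rintro ⟨hpz, hp⟩
      by_cases h : p ≤ y
      · exact Or.inl ⟨h, hp⟩
      · exact Or.inr ⟨⟨hpz, hp⟩, not_le.mp h⟩
    · rintro (⟨hpy, hp⟩ | ⟨⟨hpz, hp⟩, -⟩)
      · exact ⟨hpy.trans hyz, hp⟩
      · exact ⟨hpz, hp⟩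
  · rw [Finset.disjoint_left]
    intro p hp hp'
    rw [Nat.mem_primesLE] at hp
    rw [Finset.mem_filter] at hp'
    exact absurd hp.1 (not_le.mpr hp'.2)

/-- `G ≤ sqProd g Y`. [folklore] -/
theorem sqConst_le_sqProd (Y : ℕ) : sqConst g ≤ sqProd g Y :=
  ciInf_le ⟨0, fun _ ⟨y, hy⟩ => hy ▸ (sqProd_pos_le_one h24 y).1.le⟩ Y

/-- `G ≤ 1`. [folklore] -/
theorem sqConst_le_one : sqConst g ≤ 1 :=
  (sqConst_le_sqProd h24 0).trans (sqProd_pos_le_one h24 0).2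

/-- `sqProd g Y → G` (a non-increasing sequence bounded below). [cite: FriedlanderIwaniecASP1998, (9.8)] -/
theorem tendsto_sqProd : Tendsto (sqProd g) atTop (𝓝 (sqConst g)) :=
  tendsto_atTop_ciInf (sqProd_anti h24) ⟨0, fun _ ⟨y, hy⟩ => hy ▸ (sqProd_pos_le_one h24 y).1.le⟩

variable {K : ℝ} (h26 : ∀ p : ℕ, p.Prime → g (p ^ 2) ≤ K / (p : ℝ) ^ 2)
include h26

/-- The constant of (2.6) is nonnegative (test at `p = 2`). [folklore] -/
theorem hyp26_const_nonneg : 0 ≤ K := by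
  have h := (h24 2 Nat.prime_two).1.trans (h26 2 Nat.prime_two)
  have h4 : (0 : ℝ) < ((2 : ℕ) : ℝ) ^ 2 := by positivity
  by_contra hK
  have : K / ((2 : ℕ) : ℝ) ^ 2 < 0 := div_neg_of_neg_of_pos (not_le.mp hK) h4
  linarith

/-- `∑_{y < p ≤ z, p prime} g(p²) ≤ K/y` for `1 ≤ y ≤ z` ((2.6) and `∑_{y<n≤z} n⁻² ≤ y⁻¹`). [folklore] -/
theorem sum_filter_sq_le {y z : ℕ} (hy : 1 ≤ y) (hyz : y ≤ z) :
    ∑ p ∈ (Nat.primesLE z).filter (fun p => y < p), g (p ^ 2) ≤ K / y := by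
  have hK := hyp26_const_nonneg h24 h26
  have hsub : (Nat.primesLE z).filter (fun p => y < p) ⊆ Finset.Ioc y z := fun p hp => by
    rw [Finset.mem_filter, Nat.mem_primesLE] at hp; rw [Finset.mem_Ioc]; exact ⟨hp.2, hp.1.1⟩
  calc ∑ p ∈ (Nat.primesLE z).filter (fun p => y < p), g (p ^ 2)
      ≤ ∑ p ∈ (Nat.primesLE z).filter (fun p => y < p), K / (p : ℝ) ^ 2 :=
        Finset.sum_le_sum fun p hp => h26 p (Nat.prime_of_mem_primesLE (Finset.mem_filter.mp hp).1)
    _ ≤ ∑ n ∈ Finset.Ioc y z, K / (n : ℝ) ^ 2 :=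
        Finset.sum_le_sum_of_subset_of_nonneg hsub fun n _ _ => by positivity
    _ = K * ∑ n ∈ Finset.Ioc y z, ((n : ℝ) ^ 2)⁻¹ := by
        rw [Finset.mul_sum]; exact Finset.sum_congr rfl fun n _ => by rw [div_eq_mul_inv]
    _ ≤ K / y := by
        have h := sum_Ioc_inv_sq_le_sub (α := ℝ) (by omega : y ≠ 0) hyz
        have : 0 ≤ (z : ℝ)⁻¹ := by positivity
        rw [div_eq_mul_inv]
        nlinarith

/-- Weierstrass' inequality for the tail of the product: `1 - K/y ≤ ∏_{y < p ≤ z} (1 - g(p²)) ≤ 1`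
for `1 ≤ y ≤ z`. [folklore] -/
theorem one_sub_div_le_prod_filter {y z : ℕ} (hy : 1 ≤ y) (hyz : y ≤ z) :
    1 - K / y ≤ ∏ p ∈ (Nat.primesLE z).filter (fun p => y < p), (1 - g (p ^ 2)) ∧
      ∏ p ∈ (Nat.primesLE z).filter (fun p => y < p), (1 - g (p ^ 2)) ≤ 1 := by
  set S := (Nat.primesLE z).filter (fun p => y < p) with hS
  have hpr : ∀ p ∈ S, p.Prime := fun p hp => Nat.prime_of_mem_primesLE (Finset.mem_filter.mp hp).1
  have hu1 : ∀ p ∈ S, g (p ^ 2) ≤ 1 := fun p hp => by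
    linarith [(h24 p (hpr p hp)).2.1, (h24 p (hpr p hp)).2.2]
  have hW : 1 - ∑ p ∈ S, g (p ^ 2) ≤ ∏ p ∈ S, (1 - g (p ^ 2)) :=
    Literature.NumberTheory.Sieve.CFZ.one_sub_sum_le_prod_one_sub _ (fun p hp => (h24 p (hpr p hp)).1) hu1
  refine ⟨le_trans (by linarith [sum_filter_sq_le h24 h26 hy hyz]) hW, ?_⟩
  exact Finset.prod_le_one (fun p hp => (one_sub_sq_pos_of_hyp24 (h24 p (hpr p hp))).le)
    fun p hp => by linarith [(h24 p (hpr p hp)).1]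

/-- Tail of the product: `sqProd g y - sqProd g z ≤ K/y` for `1 ≤ y ≤ z`. [folklore] -/
theorem sqProd_sub_sqProd_le {y z : ℕ} (hy : 1 ≤ y) (hyz : y ≤ z) :
    sqProd g y - sqProd g z ≤ K / y := by
  obtain ⟨hW, hW1⟩ := one_sub_div_le_prod_filter h24 h26 hy hyz
  rw [sqProd_eq_mul_prod_filter hyz]
  have hP := sqProd_pos_le_one h24 y
  set Q := ∏ p ∈ (Nat.primesLE z).filter (fun p => y < p), (1 - g (p ^ 2)) with hQ
  calc sqProd g y - sqProd g y * Q = sqProd g y * (1 - Q) := by ring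
    _ ≤ 1 * (1 - Q) := mul_le_mul_of_nonneg_right hP.2 (by linarith)
    _ ≤ K / y := by linarith

/-- A uniform positive lower bound for the partial products: with `Y₁ = ⌊2K⌋ + 1`,
`sqProd g Y ≥ sqProd g Y₁ / 2 > 0` for all `Y` (for `Y > Y₁` the tail product is `≥ 1 - K/Y₁ ≥ 1/2`).
[folklore] -/
theorem half_sqProd_le_sqProd (Y : ℕ) : sqProd g (⌊2 * K⌋₊ + 1) / 2 ≤ sqProd g Y := by
  set Y₁ := ⌊2 * K⌋₊ + 1 with hY₁
  have hP₁ := sqProd_pos_le_one h24 Y₁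
  rcases le_or_gt Y Y₁ with hY | hY
  · have := sqProd_anti h24 hY
    linarith
  · have hKY : K / Y₁ ≤ 1 / 2 := by
      have hY₁0 : (0 : ℝ) < Y₁ := by positivity
      rw [div_le_div_iff₀ hY₁0 (by norm_num : (0 : ℝ) < 2)]
      have : 2 * K < (Y₁ : ℝ) := by
        rw [hY₁]; push_cast; exact Nat.lt_floor_add_one (2 * K)
      linarith
    obtain ⟨hW, -⟩ := one_sub_div_le_prod_filter h24 h26 (by omega : 1 ≤ Y₁) hY.le
    rw [sqProd_eq_mul_prod_filter hY.le]
    set Q := ∏ p ∈ (Nat.primesLE Y).filter (fun p => Y₁ < p), (1 - g (p ^ 2)) with hQ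
    have hQ2 : 1 / 2 ≤ Q := by linarith
    calc sqProd g Y₁ / 2 = sqProd g Y₁ * (1 / 2) := by ring
      _ ≤ sqProd g Y₁ * Q := mul_le_mul_of_nonneg_left hQ2 hP₁.1.le

/-- `G > 0` (the convergent product (9.8) of positive factors with `∑ g(p²) < ∞`). [cite: FriedlanderIwaniecASP1998, (9.8)] -/
theorem sqConst_pos : 0 < sqConst g := by
  have h := le_ciInf (half_sqProd_le_sqProd h24 h26)
  exact lt_of_lt_of_le (half_pos (sqProd_pos_le_one h24 _).1) h

/-- `0 ≤ sqProd g Y - G ≤ K/Y` for `Y ≥ 1`. [folklore] -/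
theorem sqProd_sub_sqConst_le {Y : ℕ} (hY : 1 ≤ Y) :
    0 ≤ sqProd g Y - sqConst g ∧ sqProd g Y - sqConst g ≤ K / Y := by
  refine ⟨sub_nonneg.mpr (sqConst_le_sqProd h24 Y), ?_⟩
  have h : ∀ᶠ z : ℕ in atTop, sqProd g Y - K / Y ≤ sqProd g z := by
    filter_upwards [eventually_ge_atTop Y] with z hz
    linarith [sqProd_sub_sqProd_le h24 h26 hY hz]
  have := ge_of_tendsto (tendsto_sqProd h24) h
  linarith

end Products

/-! ### The sieve constant `H̃ = H/G` ((9.13)) -/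

namespace SieveSequence

variable (A : SieveSequence)

/-- The Euler factor of `H̃`: `(1 - g̃(p))/(1 - 1/p) = [(1 - g(p))/(1 - 1/p)] / (1 - g(p²))`.
[cite: FriedlanderIwaniecASP1998, (9.13)] -/
theorem moebiusSq_eulerFactor {p : ℕ} (hp : p.Prime)
    (h : 0 ≤ A.density (p ^ 2) ∧ A.density (p ^ 2) ≤ A.density p ∧ A.density p < 1) :
    (1 - A.moebiusSq.density p) / (1 - (p : ℝ)⁻¹) =
      (1 - A.density p) / (1 - (p : ℝ)⁻¹) / (1 - A.density (p ^ 2)) := by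
  rw [moebiusSq_density, one_sub_moebiusSqDensity_prime hp h]
  have h' := (one_sub_sq_pos_of_hyp24 h).ne'
  field_simp

/-- The partial Euler products of `H̃` are those of `H` divided by `∏_{p ≤ Y}(1 - g(p²))`.
[cite: FriedlanderIwaniecASP1998, (9.13)] -/
theorem moebiusSq_prod_eulerFactor
    (h24 : ∀ p : ℕ, p.Prime → 0 ≤ A.density (p ^ 2) ∧ A.density (p ^ 2) ≤ A.density p ∧
      A.density p < 1) (Y : ℕ) :
    ∏ p ∈ Nat.primesLE Y, (1 - A.moebiusSq.density p) / (1 - (p : ℝ)⁻¹) =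
      (∏ p ∈ Nat.primesLE Y, (1 - A.density p) / (1 - (p : ℝ)⁻¹)) / sqProd A.density Y := by
  rw [sqProd, ← Finset.prod_div_distrib]
  exact Finset.prod_congr rfl fun p hp =>
    A.moebiusSq_eulerFactor (Nat.prime_of_mem_primesLE hp) (h24 p (Nat.prime_of_mem_primesLE hp))

/-- **`H̃ = H/G`** ((9.13)): if `A` has sieve constant `H` (ordered Euler product,
`HasDensityConstant`) and its density satisfies (2.4) and (2.6), then `ã = μ² a` has sieve constant
`H / G`, `G = ∏_p (1 - g(p²))`. [cite: FriedlanderIwaniecASP1998, (9.13)] -/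
theorem hasDensityConstant_moebiusSq
    (h24 : ∀ p : ℕ, p.Prime → 0 ≤ A.density (p ^ 2) ∧ A.density (p ^ 2) ≤ A.density p ∧
      A.density p < 1)
    {K : ℝ} (h26 : ∀ p : ℕ, p.Prime → A.density (p ^ 2) ≤ K / (p : ℝ) ^ 2)
    {H : ℝ} (h : A.HasDensityConstant H) :
    A.moebiusSq.HasDensityConstant (H / sqConst A.density) := by
  unfold SieveSequence.HasDensityConstant at h ⊢
  simp_rw [A.moebiusSq_prod_eulerFactor h24]
  exact h.div (tendsto_sqProd h24) (sqConst_pos h24 h26).ne'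

end SieveSequence

end Literature.NumberTheory.Sieve
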